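/-
Copyright (c) 2026 the pub-hodgecm-mathlib formalisation cell (harness21).  Prover seat hodgecm-mathlib-K2Liu-p03 (g8), Track B «K2-LIT»,
#184♮ = hLiu418 = `stmt-HodgeConjecture-24832`; socket #41, KIND 1 — (K1a-T)(L2-dock) (m1)+(m3): THE JOINT GAUSSIAN DICTIONARY `hgauss` OF ★ p864498
`hAcb_of_archLetters` FROM THE CORNER READING (K1a desk K2Liu-p01 (g11) WORD #2 (3) ∕ #9 (3); this seat's census 02:10:23Z: the decay is JOINT —
`t_w·p_w ≍ |σc X|_w·(γ̂₁ V_w γ̂₁ᴴ) ≥ c·λ_min(V_w)·‖ι_w X‖` by the rank-one `T_L`-skew structure — so ONE letter on `Σ_w t_w p_w`).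
THEOREMS ONLY (no `def`, no `instance`, no notation, no named-fact hypothesis, no `sorry`).
-/
import Summits.HodgeConjecture.HodgeConjecture.Theorems.K2LiuKindOneSingularTailWitnesses              -- ★ p864217 (A) (this seat): the presentation letters' shapes; ★ (C-b)'s frame
import Literature.NumberTheory.GelbartRogawski1991.LocalKudlaSplittingInjectiveTransported              -- ★ `gramR_eq_diagonal`
import Literature.NumberTheory.Automorphic.AdelicHeightGLProofs                                           -- ★ `adelicHeightGL_nonneg`
import HarnessLib

/-!
# Crux `HLiu418`, socket #41, KIND 1 a♮ — (K1a-T)(L2-dock)(m1)+(m3) `K2LiuKindOneSingularGaussianDictionary`: `b₀·‖h‖^{−a'}·‖ι_∞ X‖ ≤ Σ_w t_w(X)·p_w(X,h)`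

Cell `hodgecm-mathlib`, crux item hLiu418 = `stmt-HodgeConjecture-24832` (helper lane `--supports … --as helper`, count-neutral), route of record `HCCMUnconditional`;
squad K2 ∕ K2Liu, road `K2_Liu`, socket #41, KIND 1, block K1-a♮.  CONSUMER: ★ p864498 `K2LiuKindOneSingularArchDecayOfRecord.hAcb_of_archLetters`, slot (vi)
`hgauss : ∀ X h, rank-one → b₀·‖h‖^{−a₀'}·τa X ≤ Σ_{w∈Tinf} gw X h w` at `gw X h w := tw X w * pw X h w`, `τa X := ‖(ι_∞ X_ab)_ab‖`.

THE MATHEMATICS ((m3), the rank-one `T_L`-skew structure; [Shimura1997, §18.1], [KudlaRallis1994, §2]).  For `X ∈ Skew_{T_L}(L)` of rank one with ★ (A)'s presentation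
`↑X = u ⊗ w`, the normalised row section `γ̂ = γ[w]` (pivot `i`: `γ̂₁ = w_i⁻¹·w`, `γ̂_{1i} = 1`) and corner scalar `σc` (`t_i·X_ii = t₁·σc`), skewness at the entry `(a,i)`
(`t_a X_{ai} = −c(X_{ia}) t_i`) and the rank-one minors (`X_{ab}X_{ii} = X_{ai}X_{ib}`, `X_{ia} = X_{ii}·γ̂_{1a}`) give, at every complex place `w'`:
`|t_a|_{w'}·|X_{ab}|_{w'} = |t₁|_{w'}·|σc|_{w'}·|γ̂_{1a}|_{w'}·|γ̂_{1b}|_{w'}` — so `|X_{ab}|_{w'} ≤ (|t₁|∕|t_a|)·|σc|_{w'}·‖ι_{w'} γ̂₁‖²`.  With the two READING letters of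
the (o1) arch face — (a) `ct·|σc X|_{w'} ≤ tw X w'` (the corner index's Gaussian size), (b) `cp·Re⟨ι_{w'}γ̂₁, V_{w'}(h)·ι_{w'}γ̂₁⟩ ≤ pw X h w'` ((m1): the Levi translate
`Λ(map γ̂)` moves the Siegel half-space point by `Z ↦ γ̂Zγ̂ᴴ`, so the Gaussian parameter of the translate is the `γ̂₁`-diagonal value of `V_{w'}(h) = Im moeb(h_{w'}, iI)`) — and
(c) the λ_min floor `cV·‖h‖^{−aV}·‖v‖² ≤ Re⟨v, V_{w'}(h) v⟩` (★ K2E4-p10 (m2) `re_star_dotProduct_im_moeb_I_mulVec_ge` at `R := C·‖h‖`), every entry obeys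
`b₀·‖h‖^{−aV}·|X_{ab}|_{w'} ≤ tw X w'·pw X h w' ≤ Σ_w …`, `b₀ := ct·cp·cV ∕ Σ_{w',a} |t₁|_{w'}∕|t_a|_{w'}`; the sup norm `‖ι_∞ X‖` is the max over `(w', a, b)`.
* `norm_mul_norm_le_sum_sq` — `‖v a‖·‖v b‖ ≤ Σ_k ‖v k‖²` on `Fin 2`;
* **`hgauss_of_cornerReading`** — the letter: `∃ b₀ > 0, ∀ X h, rank-one → b₀·‖h‖^{−aV}·‖(ι_∞ X_ab)_ab‖ ≤ Σ_{w'∈Tinf} tw X w'·pw X h w'`.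
HONEST LABEL.  Count-neutral helper (algebra + bookkeeping; the per-place readings (a)(b) and the floor (c) are named letters of the (o1)-face ∕ (m2) hands); it closes no
socket: `HC_CM` is proved only modulo the 7 printed citations (2 remaining named inputs: hLiu418 = `stmt-HodgeConjecture-24832`, h413 = `stmt-HodgeConjecture-24833`)
until rung 0 closes.

## References
* [KudlaRallis1994] S. Kudla, S. Rallis, *A regularized Siegel–Weil formula: the first term identity*, Ann. of Math. 140 (1994): §2 (2.10)–(2.12).
* [Shimura1997] G. Shimura, *Euler Products and Eisenstein Series*, CBMS 93 (1997): §18.1, §18.4.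
* [Shimura1982] G. Shimura, *Confluent hypergeometric functions on tube domains*, Math. Ann. 260 (1982): §4.
* [MoeglinWaldspurger1995] C. Mœglin, J.-L. Waldspurger, *Spectral Decomposition and Eisenstein Series* (1995): I.2.2, II.1.7.
-/

set_option autoImplicit false
-- the mandated namespace repeats the single-problem summit's segment (`HodgeConjecture.HodgeConjecture`)
set_option linter.dupNamespace false

noncomputable section

open scoped Matrix
open NumberField NumberField.InfinitePlace IsDedekindDomain

namespace Summit.HodgeConjecture.HodgeConjecture.Cruxes.HLiu418.K2LiuKindOneSingularGaussianDictionary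

open Literature.NumberTheory.Automorphic Literature.NumberTheory.Automorphic.UnitaryGroup Literature.NumberTheory.GaloisRepresentations
open Literature.NumberTheory.GelbartRogawski1991 Literature.NumberTheory.GelbartRogawski1991.GRConstruction
open Literature.NumberTheory.GelbartRogawski1991.UnitaryDualPair
open Literature.NumberTheory.K2Lit.SiegelDoubled
open Summit.HodgeConjecture.HodgeConjecture.Cruxes.HLiu418.K2LiuSiegelUnipotentFourierDefs
open Summit.HodgeConjecture.HodgeConjecture.Cruxes.HLiu418.K2LiuSiegelMiddleCellLeviCriterion (row_ne_zero)
open Summit.HodgeConjecture.HodgeConjecture.Cruxes.HLiu418.K2LiuRankOneIndexValueTwoCorner (gramRL_apply_same_ne_zero)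

/-- on `Fin 2`, `‖v a‖·‖v b‖ ≤ Σ_k ‖v k‖²` (both for `a = b` and `a ≠ b`). [folklore] -/
theorem norm_mul_norm_le_sum_sq (v : Fin 2 → ℂ) (a b : Fin 2) : ‖v a‖ * ‖v b‖ ≤ ∑ k, ‖v k‖ ^ 2 := by
  have ha : ‖v a‖ ^ 2 ≤ ∑ k, ‖v k‖ ^ 2 := Finset.single_le_sum (f := fun k => ‖v k‖ ^ 2) (fun k _ => sq_nonneg _) (Finset.mem_univ a)
  have hb : ‖v b‖ ^ 2 ≤ ∑ k, ‖v k‖ ^ 2 := Finset.single_le_sum (f := fun k => ‖v k‖ ^ 2) (fun k _ => sq_nonneg _) (Finset.mem_univ b)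
  nlinarith [sq_nonneg (‖v a‖ - ‖v b‖), norm_nonneg (v a), norm_nonneg (v b)]

variable (L : Type) [Field L] [NumberField L] [IsCMField L]

section Dictionary

variable {N M : ℕ} (e : Fin N × Fin M ≃ Fin 2)
  (dV : Fin N → L) (hdV : ∀ i, IsCMField.complexConj L (dV i) = dV i)
  (dW : Fin M → L) (hdW : ∀ i, IsCMField.complexConj L (dW i) = dW i)

open Classical in -- the archimedean size `‖(ι_∞ X_ab)_ab‖` is read with the consumers' instances (★ p863404 ∕ ★ p864122 ∕ ★ p864498: `open Classical in`)
/-- **(K1a-T)(L2-dock)(m1)+(m3) THE JOINT GAUSSIAN DICTIONARY FROM THE CORNER READING.**  INPUTS (by value): `dV dW ≠ 0`; the complex places `Tinf` with `hall`; a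
NORMALISED row section `γ` (`hnorm` = ★ `exists_normalised_rowSection`'s entry letter); ★ (A)'s witnesses `σc u w hw` with the presentation letter (g) `hpres`; the (m0)
producer's per-place Gaussian variables `tw pw` and the half-space imaginary parts `V` with THREE letters — (a) `htw` the corner-index reading `ct·w'(σc X) ≤ tw X w'`,
(b) `hpw` the translate reading `cp·Re⟨ι_{w'}γ̂₁, V w' h ·ι_{w'}γ̂₁⟩ ≤ pw X h w'` (`γ̂₁` = row `1` of `γ[w X]`), (c) `hV` the λ_min floor `cV·‖h‖^{−aV}·Σ‖v_k‖² ≤ Re⟨v, V w' h v⟩`.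
OUTPUT: `∃ b₀ > 0, ∀ X h, ↑X ≠ 0 → det ↑X = 0 → b₀·‖h‖^{−aV}·‖(ι_∞ X_ab)_ab‖ ≤ Σ_{w'∈Tinf} tw X w'·pw X h w'` — ★ p864498's slot (vi) at `gw := tw·pw`, `a₀' := aV`,
`τa X := ‖(ι_∞ X_ab)_ab‖`. [cite: KudlaRallis1994, §2 (2.10)–(2.12)] [cite: Shimura1997, §18.1] [cite: Shimura1982, §4] [cite: MoeglinWaldspurger1995, I.2.2, II.1.7] -/
theorem hgauss_of_cornerReading (hdV0 : ∀ i, dV i ≠ 0) (hdW0 : ∀ i, dW i ≠ 0)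
    (Tinf : Finset (InfinitePlace L)) (hall : ∀ w' : InfinitePlace L, w' ∈ Tinf)
    -- a NORMALISED row section
    (γ : Projectivization L (Fin 2 → L) → GL (Fin 2) L)
    (hnorm : ∀ (w : Fin 2 → L) (hw : w ≠ 0), ∃ i : Fin 2, w i ≠ 0 ∧
      (γ (Projectivization.mk L w hw) : Matrix (Fin 2) (Fin 2) L) 1 = (w i)⁻¹ • w ∧
      ∀ a b : Fin 2,
        (∃ k : Fin 2, (γ (Projectivization.mk L w hw) : Matrix (Fin 2) (Fin 2) L) a b = 0 ∨
          (γ (Projectivization.mk L w hw) : Matrix (Fin 2) (Fin 2) L) a b = 1 ∨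
          (γ (Projectivization.mk L w hw) : Matrix (Fin 2) (Fin 2) L) a b = (w i)⁻¹ * w k ∨
          (γ (Projectivization.mk L w hw) : Matrix (Fin 2) (Fin 2) L) a b = -((w i)⁻¹ * w k)) ∧
        (∃ k : Fin 2, (((γ (Projectivization.mk L w hw))⁻¹ : GL (Fin 2) L) : Matrix (Fin 2) (Fin 2) L) a b = 0 ∨
          (((γ (Projectivization.mk L w hw))⁻¹ : GL (Fin 2) L) : Matrix (Fin 2) (Fin 2) L) a b = 1 ∨
          (((γ (Projectivization.mk L w hw))⁻¹ : GL (Fin 2) L) : Matrix (Fin 2) (Fin 2) L) a b = (w i)⁻¹ * w k ∨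
          (((γ (Projectivization.mk L w hw))⁻¹ : GL (Fin 2) L) : Matrix (Fin 2) (Fin 2) L) a b = -((w i)⁻¹ * w k)))
    -- ★ (A)'s witnesses with the presentation letter (g)
    (σc : skewMatrices ((IsCMField.complexConj L : L ≃ₐ[Fp L] L) : L →+* L) ((gramR L e dV hdV dW hdW).map (algebraMap (Fp L) L)) → L)
    (u w : skewMatrices ((IsCMField.complexConj L : L ≃ₐ[Fp L] L) : L →+* L) ((gramR L e dV hdV dW hdW).map (algebraMap (Fp L) L)) → Fin 2 → L)
    (hw : ∀ S, w S ≠ 0)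
    (hpres : ∀ S : skewMatrices ((IsCMField.complexConj L : L ≃ₐ[Fp L] L) : L →+* L) ((gramR L e dV hdV dW hdW).map (algebraMap (Fp L) L)),
      (S : Matrix (Fin 2) (Fin 2) L) ≠ 0 → (S : Matrix (Fin 2) (Fin 2) L).det = 0 →
        (S : Matrix (Fin 2) (Fin 2) L) = Matrix.vecMulVec (u S) (w S) ∧
        (∀ k : Fin 2, ((gramR L e dV hdV dW hdW).map (algebraMap (Fp L) L)) k k * (S : Matrix (Fin 2) (Fin 2) L) k k =
          IsCMField.complexConj L (((γ (Projectivization.mk L (w S) (hw S)) : GL (Fin 2) L) : Matrix (Fin 2) (Fin 2) L) 1 k) *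
            ((gramR L e dV hdV dW hdW).map (algebraMap (Fp L) L)) 1 1 * σc S * ((γ (Projectivization.mk L (w S) (hw S)) : GL (Fin 2) L) : Matrix (Fin 2) (Fin 2) L) 1 k) ∧
        gramR L e dV hdV dW hdW 1 1 * Algebra.trace (Fp L) L (σc S * imagUnit L) ≠ 0)
    -- the (m0) producer's per-place Gaussian variables and the half-space imaginary parts, BY VALUE, with the three letters (a)(b)(c)
    (tw : skewMatrices ((IsCMField.complexConj L : L ≃ₐ[Fp L] L) : L →+* L) ((gramR L e dV hdV dW hdW).map (algebraMap (Fp L) L)) → InfinitePlace L → ℝ)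
    (pw : skewMatrices ((IsCMField.complexConj L : L ≃ₐ[Fp L] L) : L →+* L) ((gramR L e dV hdV dW hdW).map (algebraMap (Fp L) L)) → HA L e dV hdV dW hdW → InfinitePlace L → ℝ)
    (V : InfinitePlace L → HA L e dV hdV dW hdW → Matrix (Fin 2) (Fin 2) ℂ)
    {ct cp cV aV : ℝ} (hct : 0 < ct) (hcp : 0 < cp) (hcV : 0 < cV)
    (htw : ∀ X : skewMatrices ((IsCMField.complexConj L : L ≃ₐ[Fp L] L) : L →+* L) ((gramR L e dV hdV dW hdW).map (algebraMap (Fp L) L)),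
      (X : Matrix (Fin 2) (Fin 2) L) ≠ 0 → (X : Matrix (Fin 2) (Fin 2) L).det = 0 → ∀ w' ∈ Tinf, ct * w' (σc X) ≤ tw X w')
    (hpw : ∀ (X : skewMatrices ((IsCMField.complexConj L : L ≃ₐ[Fp L] L) : L →+* L) ((gramR L e dV hdV dW hdW).map (algebraMap (Fp L) L))) (h : HA L e dV hdV dW hdW),
      (X : Matrix (Fin 2) (Fin 2) L) ≠ 0 → (X : Matrix (Fin 2) (Fin 2) L).det = 0 → ∀ w' ∈ Tinf,
        cp * (star (fun k => w'.embedding (((γ (Projectivization.mk L (w X) (hw X)) : GL (Fin 2) L) : Matrix (Fin 2) (Fin 2) L) 1 k)) ⬝ᵥ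
          (V w' h *ᵥ fun k => w'.embedding (((γ (Projectivization.mk L (w X) (hw X)) : GL (Fin 2) L) : Matrix (Fin 2) (Fin 2) L) 1 k))).re ≤ pw X h w')
    (hV : ∀ (h : HA L e dV hdV dW hdW), ∀ w' ∈ Tinf, ∀ v : Fin 2 → ℂ,
      cV * adelicHeightGL (2 + 2) L (h : GL (Fin (2 + 2)) (AdeleRing (𝓞 L) L)) ^ (-aV) * ∑ k, ‖v k‖ ^ 2 ≤ (star v ⬝ᵥ (V w' h *ᵥ v)).re) :
    ∃ b₀ : ℝ, 0 < b₀ ∧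
      ∀ (X : skewMatrices ((IsCMField.complexConj L : L ≃ₐ[Fp L] L) : L →+* L) ((gramR L e dV hdV dW hdW).map (algebraMap (Fp L) L))) (h : HA L e dV hdV dW hdW),
        (X : Matrix (Fin 2) (Fin 2) L) ≠ 0 → (X : Matrix (Fin 2) (Fin 2) L).det = 0 →
        b₀ * adelicHeightGL (2 + 2) L (h : GL (Fin (2 + 2)) (AdeleRing (𝓞 L) L)) ^ (-aV) * ‖(fun i j => NumberField.mixedEmbedding L ((X : Matrix (Fin 2) (Fin 2) L) i j))‖ ≤
          ∑ w' ∈ Tinf, tw X w' * pw X h w' := by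
  -- the Gram scalars `t_k = T_L k k ∈ L` (non-zero, off-diagonal zero)
  have hTL0 : ∀ k : Fin 2, ((gramR L e dV hdV dW hdW).map (algebraMap (Fp L) L)) k k ≠ 0 := fun k => gramRL_apply_same_ne_zero L e dV hdV hdV0 dW hdW hdW0 k
  have hTLoff : ∀ a b : Fin 2, a ≠ b → ((gramR L e dV hdV dW hdW).map (algebraMap (Fp L) L)) a b = 0 := fun a b hab => by
    rw [Matrix.map_apply, gramR_eq_diagonal L e dV hdV dW hdW, Matrix.diagonal_apply_ne _ hab, map_zero]
  -- THE CONSTANT: `b₀ := ct·cp·cV ∕ K`, `K := Σ_{w'∈Tinf} Σ_a w'(t₁)∕w'(t_a)`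
  set K : ℝ := ∑ w' ∈ Tinf, ∑ a : Fin 2, w' (((gramR L e dV hdV dW hdW).map (algebraMap (Fp L) L)) 1 1) / w' (((gramR L e dV hdV dW hdW).map (algebraMap (Fp L) L)) a a) with hKdef
  have hterm : ∀ (w' : InfinitePlace L) (a : Fin 2), 0 < w' (((gramR L e dV hdV dW hdW).map (algebraMap (Fp L) L)) 1 1) / w' (((gramR L e dV hdV dW hdW).map (algebraMap (Fp L) L)) a a) := fun w' a =>
    div_pos (InfinitePlace.pos_iff.2 (hTL0 1)) (InfinitePlace.pos_iff.2 (hTL0 a))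
  obtain ⟨w₀⟩ := (inferInstance : Nonempty (InfinitePlace L))
  have hK : 0 < K := Finset.sum_pos (fun w' _ => Finset.sum_pos (fun a _ => hterm w' a) Finset.univ_nonempty) ⟨w₀, hall w₀⟩
  have hKle : ∀ w' ∈ Tinf, ∀ a : Fin 2, w' (((gramR L e dV hdV dW hdW).map (algebraMap (Fp L) L)) 1 1) / w' (((gramR L e dV hdV dW hdW).map (algebraMap (Fp L) L)) a a) ≤ K := fun w' hw' a =>
    (Finset.single_le_sum (f := fun a : Fin 2 => w' (((gramR L e dV hdV dW hdW).map (algebraMap (Fp L) L)) 1 1) / w' (((gramR L e dV hdV dW hdW).map (algebraMap (Fp L) L)) a a)) (fun b _ => (hterm w' b).le) (Finset.mem_univ a)).trans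
      (Finset.single_le_sum (f := fun w' => ∑ a : Fin 2, w' (((gramR L e dV hdV dW hdW).map (algebraMap (Fp L) L)) 1 1) / w' (((gramR L e dV hdV dW hdW).map (algebraMap (Fp L) L)) a a)) (fun w'' _ => Finset.sum_nonneg fun b _ => (hterm w'' b).le) hw')
  refine ⟨ct * cp * cV / K, by positivity, fun X h hX0 hdet => ?_⟩
  -- the objects of record for this `(X, h)`
  obtain ⟨hS1, hdiag, hτ0⟩ := hpres X hX0 hdet
  obtain ⟨i, hi, hrow, -⟩ := hnorm (w X) (hw X)
  set g : Matrix (Fin 2) (Fin 2) L := ((γ (Projectivization.mk L (w X) (hw X)) : GL (Fin 2) L) : Matrix (Fin 2) (Fin 2) L) with hgdef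
  have hg1 : ∀ k, g 1 k = (w X i)⁻¹ * w X k := fun k => by rw [hrow, Pi.smul_apply, smul_eq_mul]
  have h1i : g 1 i = 1 := by rw [hg1, inv_mul_cancel₀ hi]
  have hpiv : ((gramR L e dV hdV dW hdW).map (algebraMap (Fp L) L)) i i * (X : Matrix (Fin 2) (Fin 2) L) i i = ((gramR L e dV hdV dW hdW).map (algebraMap (Fp L) L)) 1 1 * σc X := by
    have := hdiag i
    rw [h1i, map_one, one_mul, mul_one] at this
    exact this
  have hσ0 : σc X ≠ 0 := fun h0 => hτ0 (by rw [h0, zero_mul, map_zero, mul_zero])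
  have hXii : (X : Matrix (Fin 2) (Fin 2) L) i i ≠ 0 := fun h0 => by
    rw [h0, mul_zero] at hpiv
    exact mul_ne_zero (hTL0 1) hσ0 hpiv.symm
  -- the algebraic identities: rank-one minors through the pivot, and skewness at the entry `(a, i)`
  have hXia : ∀ a, (X : Matrix (Fin 2) (Fin 2) L) i a = (X : Matrix (Fin 2) (Fin 2) L) i i * g 1 a := fun a => by
    rw [hS1, Matrix.vecMulVec_apply, Matrix.vecMulVec_apply, hg1, mul_assoc, mul_inv_cancel_left₀ hi]
  have hminor : ∀ a b, (X : Matrix (Fin 2) (Fin 2) L) a b * (X : Matrix (Fin 2) (Fin 2) L) i i =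
      (X : Matrix (Fin 2) (Fin 2) L) a i * (X : Matrix (Fin 2) (Fin 2) L) i b := fun a b => by
    rw [hS1]; simp only [Matrix.vecMulVec_apply]; ring
  have hc : ∀ z : L, ((IsCMField.complexConj L : L ≃ₐ[Fp L] L) : L →+* L) z = IsCMField.complexConj L z := fun _ => rfl
  have hskew : ∀ a, ((gramR L e dV hdV dW hdW).map (algebraMap (Fp L) L)) a a * (X : Matrix (Fin 2) (Fin 2) L) a i =
      -(((IsCMField.complexConj L : L ≃ₐ[Fp L] L) : L →+* L) ((X : Matrix (Fin 2) (Fin 2) L) i a) * ((gramR L e dV hdV dW hdW).map (algebraMap (Fp L) L)) i i) := by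
    intro a
    have hai := congrFun (congrFun ((mem_skewMatrices_iff _ _ _).1 X.2) a) i
    rw [Matrix.add_apply, Matrix.zero_apply, Matrix.mul_apply, Matrix.mul_apply,
      Finset.sum_eq_single a (fun k _ hk => by rw [hTLoff a k (Ne.symm hk), zero_mul]) (fun h' => absurd (Finset.mem_univ a) h'),
      Finset.sum_eq_single i (fun k _ hk => by rw [hTLoff k i hk, mul_zero]) (fun h' => absurd (Finset.mem_univ i) h'),
      Matrix.transpose_apply, Matrix.map_apply] at hai
    exact eq_neg_of_add_eq_zero_left hai
  -- per place and per entry: `w'(t_a)·w'(X_ab) = w'(t₁)·w'(σc)·‖v a‖·‖v b‖`, `v := ι_{w'} γ̂₁`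
  have hentry : ∀ (w' : InfinitePlace L) (a b : Fin 2),
      w' (((gramR L e dV hdV dW hdW).map (algebraMap (Fp L) L)) a a) * w' ((X : Matrix (Fin 2) (Fin 2) L) a b) =
        w' (((gramR L e dV hdV dW hdW).map (algebraMap (Fp L) L)) 1 1) * w' (σc X) * ‖w'.embedding (g 1 a)‖ * ‖w'.embedding (g 1 b)‖ := by
    intro w' a b
    have hA : w' ((X : Matrix (Fin 2) (Fin 2) L) i i) ≠ 0 := (InfinitePlace.pos_iff.2 hXii).ne'
    have e1 : w' (((gramR L e dV hdV dW hdW).map (algebraMap (Fp L) L)) a a) * w' ((X : Matrix (Fin 2) (Fin 2) L) a i) = w' ((X : Matrix (Fin 2) (Fin 2) L) i a) * w' (((gramR L e dV hdV dW hdW).map (algebraMap (Fp L) L)) i i) := by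
      rw [← map_mul, hskew a, ← InfinitePlace.norm_embedding_eq, map_neg, norm_neg, map_mul, norm_mul, hc,
        IsCMField.complexEmbedding_complexConj, Complex.norm_conj, InfinitePlace.norm_embedding_eq, InfinitePlace.norm_embedding_eq]
    have e2 : w' (((gramR L e dV hdV dW hdW).map (algebraMap (Fp L) L)) i i) * w' ((X : Matrix (Fin 2) (Fin 2) L) i i) = w' (((gramR L e dV hdV dW hdW).map (algebraMap (Fp L) L)) 1 1) * w' (σc X) := by rw [← map_mul, hpiv, map_mul]
    have e3 : ∀ c, w' ((X : Matrix (Fin 2) (Fin 2) L) i c) = w' ((X : Matrix (Fin 2) (Fin 2) L) i i) * ‖w'.embedding (g 1 c)‖ := fun c => by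
      rw [hXia c, map_mul, InfinitePlace.norm_embedding_eq]
    have e4 : w' ((X : Matrix (Fin 2) (Fin 2) L) a b) * w' ((X : Matrix (Fin 2) (Fin 2) L) i i) =
        w' ((X : Matrix (Fin 2) (Fin 2) L) a i) * w' ((X : Matrix (Fin 2) (Fin 2) L) i b) := by rw [← map_mul, hminor a b, map_mul]
    apply mul_right_cancel₀ hA
    calc w' (((gramR L e dV hdV dW hdW).map (algebraMap (Fp L) L)) a a) * w' ((X : Matrix (Fin 2) (Fin 2) L) a b) * w' ((X : Matrix (Fin 2) (Fin 2) L) i i)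
        = w' (((gramR L e dV hdV dW hdW).map (algebraMap (Fp L) L)) a a) * (w' ((X : Matrix (Fin 2) (Fin 2) L) a i) * w' ((X : Matrix (Fin 2) (Fin 2) L) i b)) := by rw [mul_assoc, e4]
      _ = (w' (((gramR L e dV hdV dW hdW).map (algebraMap (Fp L) L)) a a) * w' ((X : Matrix (Fin 2) (Fin 2) L) a i)) * w' ((X : Matrix (Fin 2) (Fin 2) L) i b) := by ring
      _ = (w' ((X : Matrix (Fin 2) (Fin 2) L) i a) * w' (((gramR L e dV hdV dW hdW).map (algebraMap (Fp L) L)) i i)) * w' ((X : Matrix (Fin 2) (Fin 2) L) i b) := by rw [e1]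
      _ = (w' ((X : Matrix (Fin 2) (Fin 2) L) i i) * ‖w'.embedding (g 1 a)‖ * w' (((gramR L e dV hdV dW hdW).map (algebraMap (Fp L) L)) i i)) *
            (w' ((X : Matrix (Fin 2) (Fin 2) L) i i) * ‖w'.embedding (g 1 b)‖) := by rw [e3 a, e3 b]
      _ = (w' (((gramR L e dV hdV dW hdW).map (algebraMap (Fp L) L)) i i) * w' ((X : Matrix (Fin 2) (Fin 2) L) i i)) * ‖w'.embedding (g 1 a)‖ * ‖w'.embedding (g 1 b)‖ *
            w' ((X : Matrix (Fin 2) (Fin 2) L) i i) := by ring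
      _ = w' (((gramR L e dV hdV dW hdW).map (algebraMap (Fp L) L)) 1 1) * w' (σc X) * ‖w'.embedding (g 1 a)‖ * ‖w'.embedding (g 1 b)‖ * w' ((X : Matrix (Fin 2) (Fin 2) L) i i) := by rw [e2]
  -- per place and per entry: `b₀·‖h‖^{−aV}·w'(X_ab) ≤ tw X w'·pw X h w'`
  set H : ℝ := adelicHeightGL (2 + 2) L (h : GL (Fin (2 + 2)) (AdeleRing (𝓞 L) L)) with hHdef
  have hHpow : 0 ≤ H ^ (-aV) := Real.rpow_nonneg (adelicHeightGL_nonneg _) _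
  have hgw0 : ∀ w' ∈ Tinf, 0 ≤ tw X w' * pw X h w' := by
    intro w' hw'
    refine mul_nonneg ((mul_nonneg hct.le (apply_nonneg w' _)).trans (htw X hX0 hdet w' hw')) ?_
    refine le_trans (mul_nonneg hcp.le ?_) (hpw X h hX0 hdet w' hw')
    exact le_trans (by positivity) (hV h w' hw' _)
  have hplace : ∀ w' ∈ Tinf, ∀ a b : Fin 2,
      ct * cp * cV / K * H ^ (-aV) * w' ((X : Matrix (Fin 2) (Fin 2) L) a b) ≤ tw X w' * pw X h w' := by
    intro w' hw' a b
    set v : Fin 2 → ℂ := fun k => w'.embedding (g 1 k) with hvdef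
    have hta : 0 < w' (((gramR L e dV hdV dW hdW).map (algebraMap (Fp L) L)) a a) := InfinitePlace.pos_iff.2 (hTL0 a)
    have ht1 : 0 < w' (((gramR L e dV hdV dW hdW).map (algebraMap (Fp L) L)) 1 1) := InfinitePlace.pos_iff.2 (hTL0 1)
    -- `w'(X_ab) ≤ (w'(t₁)/w'(t_a))·w'(σc)·Σ‖v_k‖²`
    have hXab : w' ((X : Matrix (Fin 2) (Fin 2) L) a b) ≤ w' (((gramR L e dV hdV dW hdW).map (algebraMap (Fp L) L)) 1 1) / w' (((gramR L e dV hdV dW hdW).map (algebraMap (Fp L) L)) a a) * (w' (σc X) * ∑ k, ‖v k‖ ^ 2) := by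
      rw [div_mul_eq_mul_div, le_div_iff₀ hta]
      calc w' ((X : Matrix (Fin 2) (Fin 2) L) a b) * w' (((gramR L e dV hdV dW hdW).map (algebraMap (Fp L) L)) a a) = w' (((gramR L e dV hdV dW hdW).map (algebraMap (Fp L) L)) 1 1) * w' (σc X) * (‖v a‖ * ‖v b‖) := by
            rw [mul_comm, hentry w' a b, mul_assoc]
        _ ≤ w' (((gramR L e dV hdV dW hdW).map (algebraMap (Fp L) L)) 1 1) * w' (σc X) * ∑ k, ‖v k‖ ^ 2 :=
            mul_le_mul_of_nonneg_left (norm_mul_norm_le_sum_sq v a b) (mul_nonneg ht1.le (apply_nonneg w' _))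
        _ = w' (((gramR L e dV hdV dW hdW).map (algebraMap (Fp L) L)) 1 1) * (w' (σc X) * ∑ k, ‖v k‖ ^ 2) := by ring
    -- the three letters: `tw·pw ≥ (ct·w'(σc))·(cp·cV·H^{−aV}·Σ‖v_k‖²)`
    have hlow : (ct * w' (σc X)) * (cp * (cV * H ^ (-aV) * ∑ k, ‖v k‖ ^ 2)) ≤ tw X w' * pw X h w' :=
      mul_le_mul (htw X hX0 hdet w' hw') ((mul_le_mul_of_nonneg_left (hV h w' hw' v) hcp.le).trans (hpw X h hX0 hdet w' hw'))
        (by positivity) ((mul_nonneg hct.le (apply_nonneg w' _)).trans (htw X hX0 hdet w' hw'))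
    -- `1/K ≤ w'(t_a)/w'(t₁)`
    have hKinv : w' (((gramR L e dV hdV dW hdW).map (algebraMap (Fp L) L)) 1 1) / w' (((gramR L e dV hdV dW hdW).map (algebraMap (Fp L) L)) a a) / K ≤ 1 := (div_le_one hK).2 (hKle w' hw' a)
    calc ct * cp * cV / K * H ^ (-aV) * w' ((X : Matrix (Fin 2) (Fin 2) L) a b)
        ≤ ct * cp * cV / K * H ^ (-aV) * (w' (((gramR L e dV hdV dW hdW).map (algebraMap (Fp L) L)) 1 1) / w' (((gramR L e dV hdV dW hdW).map (algebraMap (Fp L) L)) a a) * (w' (σc X) * ∑ k, ‖v k‖ ^ 2)) :=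
          mul_le_mul_of_nonneg_left hXab (by positivity)
      _ = (w' (((gramR L e dV hdV dW hdW).map (algebraMap (Fp L) L)) 1 1) / w' (((gramR L e dV hdV dW hdW).map (algebraMap (Fp L) L)) a a) / K) * ((ct * w' (σc X)) * (cp * (cV * H ^ (-aV) * ∑ k, ‖v k‖ ^ 2))) := by
          field_simp
      _ ≤ 1 * ((ct * w' (σc X)) * (cp * (cV * H ^ (-aV) * ∑ k, ‖v k‖ ^ 2))) :=
          mul_le_mul_of_nonneg_right hKinv (by positivity)
      _ ≤ tw X w' * pw X h w' := by rw [one_mul]; exact hlow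
  -- ASSEMBLY: the sup norm is the max over `(a, b, w')`, each entry dominated by one summand of `Σ_{w'∈Tinf}`
  have hsum0 : 0 ≤ ∑ w' ∈ Tinf, tw X w' * pw X h w' := Finset.sum_nonneg hgw0
  by_cases hb : ct * cp * cV / K * H ^ (-aV) = 0
  · rw [hb, zero_mul]; exact hsum0
  have hbpos : 0 < ct * cp * cV / K * H ^ (-aV) := lt_of_le_of_ne (by positivity) (Ne.symm hb)
  have key : ‖(fun i j => NumberField.mixedEmbedding L ((X : Matrix (Fin 2) (Fin 2) L) i j))‖ ≤
      (∑ w' ∈ Tinf, tw X w' * pw X h w') / (ct * cp * cV / K * H ^ (-aV)) := by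
    rw [pi_norm_le_iff_of_nonneg (div_nonneg hsum0 hbpos.le)]
    intro a
    rw [pi_norm_le_iff_of_nonneg (div_nonneg hsum0 hbpos.le)]
    intro b
    rw [NumberField.mixedEmbedding.norm_eq_sup'_normAtPlace, Finset.sup'_le_iff]
    intro w' _
    rw [NumberField.mixedEmbedding.normAtPlace_apply, le_div_iff₀ hbpos, mul_comm]
    exact (hplace w' (hall w') a b).trans (Finset.single_le_sum hgw0 (hall w'))
  calc ct * cp * cV / K * H ^ (-aV) * ‖(fun i j => NumberField.mixedEmbedding L ((X : Matrix (Fin 2) (Fin 2) L) i j))‖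
      ≤ ct * cp * cV / K * H ^ (-aV) * ((∑ w' ∈ Tinf, tw X w' * pw X h w') / (ct * cp * cV / K * H ^ (-aV))) :=
        mul_le_mul_of_nonneg_left key hbpos.le
    _ = ∑ w' ∈ Tinf, tw X w' * pw X h w' := by rw [mul_div_assoc']; exact mul_div_cancel_left₀ _ hb

end Dictionary

end Summit.HodgeConjecture.HodgeConjecture.Cruxes.HLiu418.K2LiuKindOneSingularGaussianDictionary

end
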